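import Mathlib
import HarnessLib
import Summits.HubbardSuperconductivity.HubbardSuperconductivity.Theorems.KLProgrammeKLRegimeSplitFrameExtFnSymmetric
import Summits.HubbardSuperconductivity.HubbardSuperconductivity.Theorems.KLProgrammeSalmhoferCutoffDerivBound

/-!
# Route `KLProgramme`, crux K3 — Δ23: NUMERALS for the orders `j ≤ 1` of the de-interpolated G-extension — `X = 32/3` (k3c2-p2's
# `|χ₂′| ≤ 32/3`) gives `|onM (klFrameExtFn μ f) q| ≤ |mean f| + 2·G` and `‖D (onM (klFrameExtFn μ f)) q‖ ≤ (64000/3)·G`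

Cell gate-hubbard-kl, seat hubbard-kl-k3c3-p1 (g2).  The symbol-side bounds (`…SplitFrameExtFnBounds/Symmetric`) carry one non-numeral, `X ≥ sup_{l ≤ j}‖Dˡχ₂‖`.
For `j ≤ 1` the tree HAS the number: `|χ₂| ≤ 1` (`salmhoferCutoff_mem_Icc`) and `|χ₂′| ≤ 32/3` (k3c2-p2, `klcd_abs_deriv_salmhoferCutoff_le_sharp`,
`…SalmhoferCutoffDerivBound`).  So the tier-1 orders `0` and `1` of (E3a-Fn)/(E3a-V13) are fully numeral:

* `norm_iteratedFDeriv_salmhoferCutoff_le_of_le_one`: `‖Dˡχ₂(x)‖ ≤ 32/3` for `l ≤ 1`;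
* **`abs_onM_klFrameExtFn_le`** (`j = 0`): `|onM (klFrameExtFn μ f) q| ≤ |mean f| + 2·G` (`G ≥ sup|f − mean f|`; in fact `X = 1` suffices at order 0);
* **`norm_fderiv_onM_klFrameExtFn_le`** (`j = 1`): `‖iteratedFDeriv ℝ 1 (onM (klFrameExtFn μ f)) q‖ ≤ (64000/3)·G` for `G ≥ sup|f − mean f|, sup|f′|`
  (`(1!)²·(2·1!·(32/3)·200)·G·(4 + max 1 (0!/(8/5)))¹ = (12800/3)·5·G`).
Order `2` (the last tier-1 order) needs `sup|χ₂″|`, not yet a numeral in the tree.  Proofs only.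
-/

noncomputable section

namespace Summit.HubbardSuperconductivity.HubbardSuperconductivity.Theorems.KLRegimeSplit

set_option linter.dupNamespace false -- summit = problem name (single-conjunct summit), D-0017

open Real Literature.MathematicalPhysics.QuantumLattice Literature.MathematicalPhysics.QuantumLattice.FermiRG

/-- `‖Dˡχ₂(x)‖ ≤ 32/3` for `l ≤ 1` (`|χ₂| ≤ 1`, `|χ₂′| ≤ 32/3`). -/
theorem norm_iteratedFDeriv_salmhoferCutoff_le_of_le_one {l : ℕ} (hl : l ≤ 1) (x : ℝ) :
    ‖iteratedFDeriv ℝ l salmhoferCutoff x‖ ≤ 32 / 3 := by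
  rw [norm_iteratedFDeriv_eq_norm_iteratedDeriv, Real.norm_eq_abs]
  rcases Nat.le_one_iff_eq_zero_or_eq_one.mp hl with rfl | rfl
  · rw [iteratedDeriv_zero, abs_of_nonneg (salmhoferCutoff_mem_Icc x).1]
    exact (salmhoferCutoff_mem_Icc x).2.trans (by norm_num)
  · rw [iteratedDeriv_one]
    exact klcd_abs_deriv_salmhoferCutoff_le_sharp x

section Orders01

variable {f : ℝ → ℝ} {N : WithTop ℕ∞}

/-- **Order 0, numeral**: `|onM (klFrameExtFn μ f) q| ≤ |mean f| + 2·G` for `G ≥ sup|f − mean f|` (`μ ∈ klWindowC`, `f ∈ C^N`, `2π`-periodic). -/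
theorem abs_onM_klFrameExtFn_le (hf : ContDiff ℝ N f) (hper : Function.Periodic f (2 * Real.pi)) {G μ : ℝ} (hμ : μ ∈ klWindowC)
    (hG : ∀ t : ℝ, |f t - klAngularMean f| ≤ G) (q : Momentum) :
    |onM (klFrameExtFn μ f) q| ≤ |klAngularMean f| + 2 * G := by
  have hX : ∀ l ≤ 0, ∀ x : ℝ, ‖iteratedFDeriv ℝ l salmhoferCutoff x‖ ≤ 1 := by
    intro l hl x
    rw [Nat.le_zero.mp hl, norm_iteratedFDeriv_eq_norm_iteratedDeriv, Real.norm_eq_abs, iteratedDeriv_zero,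
      abs_of_nonneg (salmhoferCutoff_mem_Icc x).1]
    exact (salmhoferCutoff_mem_Icc x).2
  have hG' : ∀ i ≤ 0, ∀ t : ℝ, ‖iteratedFDeriv ℝ i (fun t => f t - klAngularMean f) t‖ ≤ G := by
    intro i hi t
    rw [Nat.le_zero.mp hi, norm_iteratedFDeriv_zero, Real.norm_eq_abs]
    exact hG t
  have h := norm_iteratedFDeriv_onM_klFrameExtFn_le hf hper (n := 0) (by simp) hμ hG' hX q
  rw [norm_iteratedFDeriv_zero, Real.norm_eq_abs] at h
  simp only [if_true, Nat.factorial_zero, Nat.cast_one, pow_zero, one_pow, mul_one] at h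
  linarith

/-- **Order 1, numeral**: `‖D (onM (klFrameExtFn μ f)) q‖ ≤ (64000/3)·G` for `G ≥ sup|f − mean f|` and `G ≥ sup|f′|`. -/
theorem norm_fderiv_onM_klFrameExtFn_le (hf : ContDiff ℝ N f) (hper : Function.Periodic f (2 * Real.pi)) (hN : (1 : WithTop ℕ∞) ≤ N)
    {G μ : ℝ} (hμ : μ ∈ klWindowC) (hG : ∀ i ≤ 1, ∀ t : ℝ, ‖iteratedFDeriv ℝ i (fun t => f t - klAngularMean f) t‖ ≤ G) (q : Momentum) :
    ‖iteratedFDeriv ℝ 1 (onM (klFrameExtFn μ f)) q‖ ≤ 64000 / 3 * G := by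
  have h := norm_iteratedFDeriv_onM_klFrameExtFn_le hf hper (n := 1) (by exact_mod_cast hN) hμ hG
    (fun l hl x => norm_iteratedFDeriv_salmhoferCutoff_le_of_le_one hl x) q
  have hG0 : 0 ≤ G := le_trans (norm_nonneg _) (hG 0 (Nat.zero_le _) 0)
  simp only [Nat.factorial, Nat.succ_eq_add_one, zero_add, mul_one, Nat.cast_one, one_pow, one_mul, pow_one, Nat.sub_self,
    if_neg one_ne_zero, zero_add] at h
  have hmax : max (1 : ℝ) (1 / (8 / 5)) = 1 := by norm_num
  rw [hmax] at h
  linarith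

end Orders01

end Summit.HubbardSuperconductivity.HubbardSuperconductivity.Theorems.KLRegimeSplit

end
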